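import Literature.AlgebraicGeometry.ProjectiveSpace.CyclicPolytopeGaleComplex
import HarnessLib

/-!
# The boundary of the `n`-gon: the cycle `Δ(n,2)`, its face numbers, `h = (1, n−2, 1)`, and the
# Euler condition (Bruns–Herzog Thm. 5.2.11 / Cor. 5.2.17 for `d = 2`; Stanley, Problem 6 with `d = 2`)

Topic `Literature/AlgebraicGeometry/ProjectiveSpace`, namespace
`Literature.AlgebraicGeometry.ProjectiveSpace`. Lane `lit-hodgefound`, seat `lit-hodgefound-p32`,
row gen30-#8. Theorems only (no `def`, no named fact).

## The sources, as printed

W. Bruns, J. Herzog, *Cohen–Macaulay Rings* (rev. ed.), §5.2: Thm. 5.2.11 (the faces of the cyclic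
polytope `C(n,d)` by Gale's evenness condition), Cor. 5.2.12, and for `d = 2`: `C(n,2)` is a convex
`n`-gon, whose boundary complex is the `n`-cycle; Cor. 5.2.17 (Euler relation) and Def. 5.4.1 /
Thm. 5.4.2 (Euler complexes, Dehn–Sommerville `h_i = h_{d−i}`); Lemma 5.1.8 (`h` from `f`).
R. P. Stanley, *Combinatorics and Commutative Algebra* (2nd ed.), Problems on Simplicial Complexes,
**Problem 6** ("find the `h`-vector `h(Δ(n,d))`"), here `d = 2`.

## What is here

On the vertex set `Fin n` (integers mod `n`, `n ≥ 3`) the **`n`-gon** is the complex with the `n`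
facets `{a, a + 1}` (addition in `Fin n`, so the last edge is `{n−1, 0}`); as everywhere in this series
it is the facet family `𝓟(n) = {{a, a+1} : a ∈ Fin n}`, a `Finset (Finset (Fin n))`.

* § 1 the edges `{a, a+1}` are `n` distinct `2`-sets; every vertex lies on exactly the two edges
  `{v, v+1}`, `{v−1, v}`.
* § 2 the faces are `∅`, the `n` vertices and the `n` edges: `f(Δ(n,2)) = (n, n)`,
  **`Σ_{faces} t^{|G|}(1−t)^{2−|G|} = 1 + (n−2)t + t²`, i.e. `h(Δ(n,2)) = (1, n−2, 1)`** — also for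
  `(1 − t)² H_{k[Δ(n,2)]}(t)` (`k` infinite); `dim k[Δ(n,2)] = 2`.
* § 3 **the `n`-gon is an Euler complex** (`d = 2`): `Σ_{M ⊇ G} (−1)^{|M|} = 1` at every face — at `∅`:
  `1 − n + n`; at a vertex: `−1 + 2`; at an edge: `1`.
* § 4 **`Δ(n,2)` IS the `n`-gon**: a `2`-subset of `Fin n` satisfies Gale's evenness condition iff it
  is an edge `{a, a+1}` (Thm. 5.2.11 for `d = 2`), so the Gale facet family of
  `CyclicPolytopeGaleComplex` with `d = 2` equals `𝓟(n)`.

## References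

* [BrunsHerzog1998] W. Bruns, J. Herzog, *Cohen–Macaulay Rings*, rev. ed., CUP 1998, Thm. 5.2.11,
  Cor. 5.2.12, Cor. 5.2.17, Def. 5.4.1, Thm. 5.4.2, Lemma 5.1.8.
* [Stanley1996] R. P. Stanley, *Combinatorics and Commutative Algebra*, 2nd ed., Birkhäuser 1996,
  Problems on Simplicial Complexes and their Face Rings, Problem 6.
-/

noncomputable section

open Module Finset PowerSeries
open Literature.RingTheory.MvPolynomial

universe u

namespace Literature.AlgebraicGeometry.ProjectiveSpace

variable {n : ℕ} [NeZero n]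

/-! ### § 0 Arithmetic in `Fin n` -/

/-- `1 < n ⟹ (1 : Fin n) = 1` as a natural number. [folklore] -/
private theorem val_one_of_le (hn : 2 ≤ n) : ((1 : Fin n) : ℕ) = 1 := by
  rw [Fin.val_one', Nat.mod_eq_of_lt (by omega)]

/-- `a + 1 ≠ a` in `Fin n`, `n ≥ 2`. [folklore] -/
private theorem add_one_ne_self (hn : 2 ≤ n) (a : Fin n) : a + 1 ≠ a := by
  intro h
  have h1 : (1 : Fin n) = 0 := add_eq_left.mp h
  have h2 := congrArg Fin.val h1
  rw [val_one_of_le hn, Fin.val_zero] at h2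
  exact one_ne_zero h2

/-- `a + 1 + 1 ≠ a` in `Fin n`, `n ≥ 3`. [folklore] -/
private theorem add_one_add_one_ne_self (hn : 3 ≤ n) (a : Fin n) : a + 1 + 1 ≠ a := by
  intro h
  rw [add_assoc] at h
  have h1 : (1 + 1 : Fin n) = 0 := add_eq_left.mp h
  have h2 := congrArg Fin.val h1
  rw [Fin.val_add, val_one_of_le (by omega), Fin.val_zero, Nat.mod_eq_of_lt (by omega)] at h2
  omega

/-- `a − 1 + 1 = a` and `a − 1 ≠ a`, `a + 1 ≠ a − 1` (`n ≥ 3`). [folklore] -/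
private theorem add_one_ne_sub_one (hn : 3 ≤ n) (a : Fin n) : a + 1 ≠ a - 1 := by
  intro h
  have h' : a - 1 + 1 + 1 = a - 1 := by rw [sub_add_cancel, h]
  exact add_one_add_one_ne_self hn _ h'

/-! ### § 1 The edges -/

/-- **Every edge `{a, a+1}` has two vertices** (`n ≥ 2`). [cite: BrunsHerzog1998, Thm. 5.2.11] -/
theorem card_polygon_edge (hn : 2 ≤ n) (a : Fin n) : ({a, a + 1} : Finset (Fin n)).card = 2 :=
  Finset.card_pair (add_one_ne_self hn a).symm

/-- All facets of the `n`-gon have two vertices: it is pure of dimension `1`.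
[cite: BrunsHerzog1998, Thm. 5.2.11] -/
theorem forall_card_polygon (hn : 2 ≤ n) :
    ∀ F ∈ (univ : Finset (Fin n)).image (fun a : Fin n => ({a, a + 1} : Finset (Fin n))), F.card = 2 := by
  intro F hF
  obtain ⟨a, -, rfl⟩ := Finset.mem_image.mp hF
  exact card_polygon_edge hn a

/-- **`a ↦ {a, a+1}` is injective** (`n ≥ 3`; for `n = 2` the two "edges" coincide).
[cite: BrunsHerzog1998, Cor. 5.2.12] -/
theorem polygon_edge_injective (hn : 3 ≤ n) :
    Function.Injective (fun a : Fin n => ({a, a + 1} : Finset (Fin n))) := by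
  intro a b h
  have ha : a ∈ ({b, b + 1} : Finset (Fin n)) := by
    rw [← show ({a, a + 1} : Finset (Fin n)) = {b, b + 1} from h]
    exact Finset.mem_insert_self _ _
  rw [Finset.mem_insert, Finset.mem_singleton] at ha
  rcases ha with ha | ha
  · exact ha
  · have hb : b ∈ ({a, a + 1} : Finset (Fin n)) := by
      rw [show ({a, a + 1} : Finset (Fin n)) = {b, b + 1} from h]
      exact Finset.mem_insert_self _ _
    rw [Finset.mem_insert, Finset.mem_singleton] at hb
    rcases hb with hb | hb
    · exact hb.symm
    · exfalso
      rw [ha] at hb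
      exact add_one_add_one_ne_self hn b hb.symm

/-- **The `n`-gon has `n` edges** (`n ≥ 3`). [cite: BrunsHerzog1998, Thm. 5.2.11 and Cor. 5.2.12] -/
theorem card_polygon_facets (hn : 3 ≤ n) :
    ((univ : Finset (Fin n)).image (fun a : Fin n => ({a, a + 1} : Finset (Fin n)))).card = n := by
  rw [Finset.card_image_of_injective _ (polygon_edge_injective hn), Finset.card_univ, Fintype.card_fin]

/-- **Every vertex lies on exactly the two edges `{v, v+1}` and `{v−1, v}`.**
[cite: BrunsHerzog1998, Thm. 5.2.11] -/
theorem filter_polygon_facets_mem (v : Fin n) :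
    ((univ : Finset (Fin n)).image (fun a : Fin n => ({a, a + 1} : Finset (Fin n)))).filter
        (fun F => v ∈ F) = {{v, v + 1}, {v - 1, v}} := by
  ext F
  simp only [Finset.mem_filter, Finset.mem_image, Finset.mem_univ, true_and, Finset.mem_insert,
    Finset.mem_singleton]
  constructor
  · rintro ⟨⟨a, rfl⟩, hv⟩
    rw [Finset.mem_insert, Finset.mem_singleton] at hv
    rcases hv with rfl | rfl
    · exact Or.inl rfl
    · right
      rw [add_sub_cancel_right]
  · rintro (rfl | rfl)
    · exact ⟨⟨v, rfl⟩, Finset.mem_insert_self _ _⟩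
    · refine ⟨⟨v - 1, by rw [sub_add_cancel]⟩, ?_⟩
      exact Finset.mem_insert_of_mem (Finset.mem_singleton_self _)

/-- The two edges at a vertex are distinct (`n ≥ 3`), so **every vertex lies on exactly `2` edges**.
[cite: BrunsHerzog1998, Thm. 5.2.11] -/
theorem card_filter_polygon_facets_mem (hn : 3 ≤ n) (v : Fin n) :
    (((univ : Finset (Fin n)).image (fun a : Fin n => ({a, a + 1} : Finset (Fin n)))).filter
        (fun F => v ∈ F)).card = 2 := by
  rw [filter_polygon_facets_mem v]
  refine Finset.card_pair fun h => ?_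
  have h1 : v + 1 ∈ ({v - 1, v} : Finset (Fin n)) := by
    rw [← h]
    exact Finset.mem_insert_of_mem (Finset.mem_singleton_self _)
  rw [Finset.mem_insert, Finset.mem_singleton] at h1
  rcases h1 with h1 | h1
  · exact add_one_ne_sub_one hn v h1
  · exact add_one_ne_self (by omega) v h1

/-! ### § 2 Faces, `f = (n, n)` and `h = (1, n−2, 1)` -/

/-- **The faces of the `n`-gon are the sets with at most one vertex and the edges** (`n ≥ 1`).
[cite: BrunsHerzog1998, Thm. 5.2.11] -/
theorem mem_biUnion_powerset_polygon_iff (G : Finset (Fin n)) :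
    G ∈ ((univ : Finset (Fin n)).image (fun a : Fin n => ({a, a + 1} : Finset (Fin n)))).biUnion
        Finset.powerset ↔ G.card ≤ 1 ∨ ∃ a : Fin n, G = {a, a + 1} := by
  constructor
  · intro hG
    obtain ⟨F, hF, hGF⟩ := Finset.mem_biUnion.mp hG
    obtain ⟨a, -, rfl⟩ := Finset.mem_image.mp hF
    rw [Finset.mem_powerset] at hGF
    by_cases hc : G.card ≤ 1
    · exact Or.inl hc
    · right
      refine ⟨a, Finset.eq_of_subset_of_card_le hGF ?_⟩
      exact (Finset.card_insert_le _ _).trans (by rw [Finset.card_singleton]; omega)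
  · rintro (hG | ⟨a, rfl⟩)
    · rcases Nat.le_one_iff_eq_zero_or_eq_one.mp hG with h0 | h1
      · rw [Finset.card_eq_zero] at h0
        subst h0
        exact Finset.mem_biUnion.mpr ⟨{0, 0 + 1}, Finset.mem_image.mpr ⟨0, Finset.mem_univ _, rfl⟩,
          Finset.mem_powerset.mpr (Finset.empty_subset _)⟩
      · obtain ⟨v, rfl⟩ := Finset.card_eq_one.mp h1
        exact Finset.mem_biUnion.mpr ⟨{v, v + 1}, Finset.mem_image.mpr ⟨v, Finset.mem_univ _, rfl⟩,
          Finset.mem_powerset.mpr (Finset.singleton_subset_iff.mpr (Finset.mem_insert_self _ _))⟩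
    · exact Finset.mem_biUnion.mpr ⟨{a, a + 1}, Finset.mem_image.mpr ⟨a, Finset.mem_univ _, rfl⟩,
        Finset.mem_powerset.mpr subset_rfl⟩

/-- **`f_0 = n`: the vertices** — the one-element faces are all `n` singletons.
[cite: BrunsHerzog1998, Thm. 5.2.11] -/
theorem card_filter_card_one_polygon :
    ((((univ : Finset (Fin n)).image (fun a : Fin n => ({a, a + 1} : Finset (Fin n)))).biUnion
        Finset.powerset).filter (fun G => G.card = 1)).card = n := by
  have h : (((univ : Finset (Fin n)).image (fun a : Fin n => ({a, a + 1} : Finset (Fin n)))).biUnion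
      Finset.powerset).filter (fun G => G.card = 1) = (univ : Finset (Fin n)).image (fun v => {v}) := by
    ext G
    rw [Finset.mem_filter, mem_biUnion_powerset_polygon_iff, Finset.mem_image]
    constructor
    · rintro ⟨-, hG⟩
      obtain ⟨v, rfl⟩ := Finset.card_eq_one.mp hG
      exact ⟨v, Finset.mem_univ _, rfl⟩
    · rintro ⟨v, -, rfl⟩
      exact ⟨Or.inl (by rw [Finset.card_singleton]), Finset.card_singleton v⟩
  rw [h, Finset.card_image_of_injective _ Finset.singleton_injective, Finset.card_univ, Fintype.card_fin]

/-- **`f_1 = n`: the edges** — the two-element faces are the `n` edges (`n ≥ 3`).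
[cite: BrunsHerzog1998, Thm. 5.2.11] -/
theorem card_filter_card_two_polygon (hn : 3 ≤ n) :
    ((((univ : Finset (Fin n)).image (fun a : Fin n => ({a, a + 1} : Finset (Fin n)))).biUnion
        Finset.powerset).filter (fun G => G.card = 2)).card = n := by
  have h : (((univ : Finset (Fin n)).image (fun a : Fin n => ({a, a + 1} : Finset (Fin n)))).biUnion
      Finset.powerset).filter (fun G => G.card = 2) =
      (univ : Finset (Fin n)).image (fun a : Fin n => ({a, a + 1} : Finset (Fin n))) := by
    ext G
    rw [Finset.mem_filter, mem_biUnion_powerset_polygon_iff, Finset.mem_image]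
    constructor
    · rintro ⟨hG | ⟨a, rfl⟩, hG2⟩
      · omega
      · exact ⟨a, Finset.mem_univ _, rfl⟩
    · rintro ⟨a, -, rfl⟩
      exact ⟨Or.inr ⟨a, rfl⟩, card_polygon_edge (by omega) a⟩
  rw [h, card_polygon_facets hn]

/-- No face has three or more vertices. [cite: BrunsHerzog1998, Thm. 5.2.11] -/
theorem card_le_two_of_mem_biUnion_powerset_polygon {G : Finset (Fin n)}
    (hG : G ∈ ((univ : Finset (Fin n)).image (fun a : Fin n => ({a, a + 1} : Finset (Fin n)))).biUnion
        Finset.powerset) : G.card ≤ 2 := by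
  obtain ⟨F, hF, hGF⟩ := Finset.mem_biUnion.mp hG
  obtain ⟨a, -, rfl⟩ := Finset.mem_image.mp hF
  exact (Finset.card_le_card (Finset.mem_powerset.mp hGF)).trans (Finset.card_insert_le _ _)

/-- A sum over the faces of the `n`-gon, sorted by the number of vertices (`0`, `1` or `2`).
[cite: BrunsHerzog1998, Lemma 5.1.8] -/
theorem sum_biUnion_powerset_polygon {R : Type*} [AddCommMonoid R] (hn : 3 ≤ n) (g : ℕ → R) :
    ∑ G ∈ ((univ : Finset (Fin n)).image (fun a : Fin n => ({a, a + 1} : Finset (Fin n)))).biUnion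
        Finset.powerset, g G.card = g 0 + n • g 1 + n • g 2 := by
  set Φ := ((univ : Finset (Fin n)).image (fun a : Fin n => ({a, a + 1} : Finset (Fin n)))).biUnion
    Finset.powerset with hΦ
  rw [← Finset.sum_fiberwise_of_maps_to (s := Φ) (t := Finset.range 3) (g := Finset.card)
    (fun G hG => Finset.mem_range.mpr (Nat.lt_succ_of_le (card_le_two_of_mem_biUnion_powerset_polygon hG)))
    (fun G : Finset (Fin n) => g G.card)]
  have hfib : ∀ j, ∑ G ∈ Φ.filter (fun G => G.card = j), g G.card =
      (Φ.filter (fun G => G.card = j)).card • g j := fun j => by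
    rw [← Finset.sum_const]
    exact Finset.sum_congr rfl fun G hG => by rw [(Finset.mem_filter.mp hG).2]
  simp only [Finset.sum_range_succ, Finset.sum_range_zero, zero_add, hfib]
  rw [hΦ, card_filter_card_eq_zero_biUnion_powerset
      ⟨{0, 0 + 1}, Finset.mem_image.mpr ⟨0, Finset.mem_univ _, rfl⟩⟩,
    card_filter_card_one_polygon, card_filter_card_two_polygon hn, one_smul]

/-- **The face polynomial of the `n`-gon: `Σ_{faces} t^{|G|} = 1 + n t + n t²`** (`f_{−1} = 1`,
`f_0 = f_1 = n`; `n ≥ 3`). [cite: BrunsHerzog1998, Thm. 5.2.11] -/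
theorem sum_faces_polygon_X_pow (hn : 3 ≤ n) :
    ∑ G ∈ ((univ : Finset (Fin n)).image (fun a : Fin n => ({a, a + 1} : Finset (Fin n)))).biUnion
        Finset.powerset, (Polynomial.X : Polynomial ℤ) ^ G.card =
      1 + (n : Polynomial ℤ) * Polynomial.X + (n : Polynomial ℤ) * Polynomial.X ^ 2 := by
  rw [sum_biUnion_powerset_polygon hn (fun i => (Polynomial.X : Polynomial ℤ) ^ i)]
  simp only [pow_zero, pow_one, nsmul_eq_mul]

/-- **The `h`-polynomial of the `n`-gon: `Σ_{faces} t^{|G|}(1 − t)^{2−|G|} = 1 + (n − 2)t + t²`**, i.e.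
**`h(Δ(n,2)) = (1, n−2, 1)`** (`(1−t)² + n t(1−t) + n t²`; `n ≥ 3`). [cite: BrunsHerzog1998,
Lemma 5.1.8 and Thm. 5.2.11] [cite: Stanley1996, Problems on Simplicial Complexes, Problem 6] -/
theorem sum_faces_polygon_X_pow_mul_one_sub_X_pow (hn : 3 ≤ n) :
    ∑ G ∈ ((univ : Finset (Fin n)).image (fun a : Fin n => ({a, a + 1} : Finset (Fin n)))).biUnion
        Finset.powerset, (Polynomial.X : Polynomial ℤ) ^ G.card * (1 - Polynomial.X) ^ (2 - G.card) =
      Polynomial.X ^ 2 + ((n : Polynomial ℤ) - 2) * Polynomial.X + 1 := by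
  rw [sum_biUnion_powerset_polygon hn
    (fun i => (Polynomial.X : Polynomial ℤ) ^ i * (1 - Polynomial.X) ^ (2 - i))]
  simp only [pow_zero, one_mul, Nat.sub_zero, pow_one, nsmul_eq_mul, Nat.sub_self, mul_one,
    show (2 - 1 : ℕ) = 1 from rfl]
  ring

section HilbertSeries

variable {k : Type u} [Field k]

omit [NeZero n] in
/-- The face-sum `h`-polynomial grouped by face size and coerced into `ℤ⟦t⟧`. [folklore] -/
private theorem coe_sum_fVector_int'' (Φ : Finset (Finset (Fin n))) (d : ℕ) :
    ((∑ j ∈ Finset.range (d + 1), ((Φ.filter (fun F => F.card = j)).card : Polynomial ℤ) *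
        ((Polynomial.X : Polynomial ℤ) ^ j * (1 - Polynomial.X) ^ (d - j)) : Polynomial ℤ) : ℤ⟦X⟧) =
      ∑ j ∈ Finset.range (d + 1), ((Φ.filter (fun F => F.card = j)).card : ℤ⟦X⟧) *
        ((PowerSeries.X : ℤ⟦X⟧) ^ j * (1 - PowerSeries.X) ^ (d - j)) := by
  rw [← Polynomial.coeToPowerSeries.ringHom_apply, map_sum]
  refine Finset.sum_congr rfl fun j _ => ?_
  rw [map_mul, map_mul, map_pow, map_pow, map_sub, map_one, map_natCast,
    Polynomial.coeToPowerSeries.ringHom_apply, Polynomial.coe_X]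

/-- **`(1 − t)² H_{k[Δ(n,2)]}(t) = 1 + (n − 2)t + t²`**: the Hilbert series of the Stanley–Reisner
ring of the `n`-gon (`n ≥ 3`, `k` infinite). [cite: BrunsHerzog1998, Lemma 5.1.8]
[cite: Stanley1996, Problems on Simplicial Complexes, Problem 6] -/
theorem one_sub_X_pow_mul_hilbertSeries_polygon [Infinite k] (hn : 3 ≤ n) :
    (1 - PowerSeries.X : ℤ⟦X⟧) ^ 2 * PowerSeries.mk (fun e =>
        ((finrank k (MvPolynomial.homogeneousSubmodule (Fin n) k e) -
          finrank k (idealDegree (projVanishingIdeal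
            {p : Fin n → k | ∃ F ∈ (univ : Finset (Fin n)).image
              (fun a : Fin n => ({a, a + 1} : Finset (Fin n))), ∀ v ∉ F, p v = 0}) e) : ℕ) : ℤ)) =
      PowerSeries.X ^ 2 + ((n : ℤ⟦X⟧) - 2) * PowerSeries.X + 1 := by
  rw [one_sub_X_pow_mul_hilbertSeries (fun F hF => (forall_card_polygon (by omega) F hF).le),
    ← coe_sum_fVector_int'',
    ← sum_faces_eq_sum_fVector _ (fun G hG => card_le_two_of_mem_biUnion_powerset_polygon hG),
    sum_faces_polygon_X_pow_mul_one_sub_X_pow hn, ← Polynomial.coeToPowerSeries.ringHom_apply,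
    map_add, map_add, map_pow, map_mul, map_sub, map_natCast, map_ofNat, map_one,
    Polynomial.coeToPowerSeries.ringHom_apply, Polynomial.coe_X]

/-- **`h(Δ(n,2)) = (1, n − 2, 1)`** as the coefficients of `(1 − t)² H_{k[Δ(n,2)]}(t)` (`n ≥ 3`,
`k` infinite). [cite: BrunsHerzog1998, Lemma 5.1.8 and Thm. 5.4.2] [cite: Stanley1996, Problems on
Simplicial Complexes, Problem 6] -/
theorem coeff_one_sub_X_pow_mul_hilbertSeries_polygon [Infinite k] (hn : 3 ≤ n) :
    (PowerSeries.coeff 0 ((1 - PowerSeries.X : ℤ⟦X⟧) ^ 2 * PowerSeries.mk (fun e =>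
        ((finrank k (MvPolynomial.homogeneousSubmodule (Fin n) k e) -
          finrank k (idealDegree (projVanishingIdeal
            {p : Fin n → k | ∃ F ∈ (univ : Finset (Fin n)).image
              (fun a : Fin n => ({a, a + 1} : Finset (Fin n))), ∀ v ∉ F, p v = 0}) e) : ℕ) : ℤ))) = 1) ∧
    (PowerSeries.coeff 1 ((1 - PowerSeries.X : ℤ⟦X⟧) ^ 2 * PowerSeries.mk (fun e =>
        ((finrank k (MvPolynomial.homogeneousSubmodule (Fin n) k e) -
          finrank k (idealDegree (projVanishingIdeal
            {p : Fin n → k | ∃ F ∈ (univ : Finset (Fin n)).image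
              (fun a : Fin n => ({a, a + 1} : Finset (Fin n))), ∀ v ∉ F, p v = 0}) e) : ℕ) : ℤ))) =
        (n : ℤ) - 2) ∧
    (PowerSeries.coeff 2 ((1 - PowerSeries.X : ℤ⟦X⟧) ^ 2 * PowerSeries.mk (fun e =>
        ((finrank k (MvPolynomial.homogeneousSubmodule (Fin n) k e) -
          finrank k (idealDegree (projVanishingIdeal
            {p : Fin n → k | ∃ F ∈ (univ : Finset (Fin n)).image
              (fun a : Fin n => ({a, a + 1} : Finset (Fin n))), ∀ v ∉ F, p v = 0}) e) : ℕ) : ℤ))) = 1) := by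
  rw [one_sub_X_pow_mul_hilbertSeries_polygon hn]
  refine ⟨?_, ?_, ?_⟩
  · simp
  · rw [map_add, map_add, PowerSeries.coeff_X_pow, if_neg (by norm_num), sub_mul, map_sub,
      show (n : ℤ⟦X⟧) = PowerSeries.C (n : ℤ) by rw [map_natCast], PowerSeries.coeff_C_mul,
      PowerSeries.coeff_one_X, show (2 : ℤ⟦X⟧) * PowerSeries.X = PowerSeries.C (2 : ℤ) * PowerSeries.X by
        rw [map_ofNat], PowerSeries.coeff_C_mul, PowerSeries.coeff_one_X, PowerSeries.coeff_one,
      if_neg (by norm_num)]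
    ring
  · rw [map_add, map_add, PowerSeries.coeff_X_pow, if_pos rfl, sub_mul, map_sub,
      show (n : ℤ⟦X⟧) = PowerSeries.C (n : ℤ) by rw [map_natCast], PowerSeries.coeff_C_mul,
      PowerSeries.coeff_X, if_neg (by norm_num),
      show (2 : ℤ⟦X⟧) * PowerSeries.X = PowerSeries.C (2 : ℤ) * PowerSeries.X by rw [map_ofNat],
      PowerSeries.coeff_C_mul, PowerSeries.coeff_X, if_neg (by norm_num), PowerSeries.coeff_one,
      if_neg (by norm_num)]
    ring

/-- **`dim k[Δ(n,2)] = 2`** (`n ≥ 2`, `k` infinite). [cite: BrunsHerzog1998, Thm. 5.1.4] -/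
theorem ringKrullDim_polygon [Infinite k] (hn : 2 ≤ n) :
    ringKrullDim (MvPolynomial (Fin n) k ⧸
        projVanishingIdeal {p : Fin n → k | ∃ F ∈ (univ : Finset (Fin n)).image
          (fun a : Fin n => ({a, a + 1} : Finset (Fin n))), ∀ v ∉ F, p v = 0}) = (2 : ℕ) := by
  rw [← card_polygon_edge hn (0 : Fin n)]
  exact ringKrullDim_quotient_projVanishingIdeal_coordArrangement_eq_card
    (Finset.mem_image.mpr ⟨0, Finset.mem_univ _, rfl⟩)
    fun G hG => by rw [card_polygon_edge hn, forall_card_polygon hn G hG]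

end HilbertSeries

/-! ### § 3 The `n`-gon is an Euler complex -/

/-- **The `n`-gon is an Euler complex** (`d = 2`, `n ≥ 3`): in the tree's interval form,
`Σ_{M face, G ⊆ M} (−1)^{|M|} = (−1)² = 1` at every face `G` — at `∅` the sum is `1 − n + n`, at a
vertex `−1 + 2` (two edges through it), at an edge `1`. [cite: BrunsHerzog1998, Def. 5.4.1 and
Cor. 5.2.17] -/
theorem euler_polygon (hn : 3 ≤ n) :
    ∀ G ∈ ((univ : Finset (Fin n)).image (fun a : Fin n => ({a, a + 1} : Finset (Fin n)))).biUnion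
        Finset.powerset,
      ∑ M ∈ (((univ : Finset (Fin n)).image (fun a : Fin n => ({a, a + 1} : Finset (Fin n)))).biUnion
        Finset.powerset).filter (fun M => G ⊆ M), (-1 : ℤ) ^ M.card = (-1) ^ 2 := by
  set Φ := ((univ : Finset (Fin n)).image (fun a : Fin n => ({a, a + 1} : Finset (Fin n)))).biUnion
    Finset.powerset with hΦ
  intro G hG
  rw [even_two.neg_one_pow]
  rcases (mem_biUnion_powerset_polygon_iff G).mp hG with hG1 | ⟨a, rfl⟩
  · rcases Nat.le_one_iff_eq_zero_or_eq_one.mp hG1 with h0 | h1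
    · -- `G = ∅`: all faces
      rw [Finset.card_eq_zero] at h0
      subst h0
      rw [Finset.filter_true_of_mem fun M _ => Finset.empty_subset M, hΦ,
        sum_biUnion_powerset_polygon hn (fun i => (-1 : ℤ) ^ i)]
      simp only [pow_zero, pow_one, nsmul_eq_mul, even_two.neg_one_pow, mul_one]
      ring
    · -- `G = {v}`: the vertex and its two edges
      obtain ⟨v, rfl⟩ := Finset.card_eq_one.mp h1
      have hset : Φ.filter (fun M => {v} ⊆ M) = insert {v} ({{v, v + 1}, {v - 1, v}}) := by
        ext M
        rw [Finset.mem_filter, Finset.singleton_subset_iff, hΦ, mem_biUnion_powerset_polygon_iff,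
          Finset.mem_insert, ← filter_polygon_facets_mem v, Finset.mem_filter, Finset.mem_image]
        constructor
        · rintro ⟨hM | ⟨a, rfl⟩, hvM⟩
          · left
            obtain ⟨w, rfl⟩ := Finset.card_eq_one.mp (le_antisymm hM (Finset.card_pos.mpr ⟨v, hvM⟩))
            rw [Finset.mem_singleton.mp hvM]
          · exact Or.inr ⟨⟨a, Finset.mem_univ _, rfl⟩, hvM⟩
        · rintro (rfl | ⟨⟨a, -, rfl⟩, hvM⟩)
          · exact ⟨Or.inl (by rw [Finset.card_singleton]), Finset.mem_singleton_self v⟩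
          · exact ⟨Or.inr ⟨a, rfl⟩, hvM⟩
      rw [hset, Finset.sum_insert, Finset.card_singleton, pow_one]
      · have h2 : ∑ M ∈ ({{v, v + 1}, {v - 1, v}} : Finset (Finset (Fin n))), (-1 : ℤ) ^ M.card = 2 := by
          rw [← filter_polygon_facets_mem v, Finset.sum_congr rfl fun M hM => by
            rw [forall_card_polygon (by omega) M (Finset.mem_filter.mp hM).1],
            Finset.sum_const, card_filter_polygon_facets_mem hn v]
          norm_num
        rw [h2]
        norm_num
      · rw [← filter_polygon_facets_mem v, Finset.mem_filter]
        rintro ⟨h, -⟩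
        have := forall_card_polygon (by omega) _ h
        rw [Finset.card_singleton] at this
        omega
  · -- `G` an edge: only itself
    have hset : Φ.filter (fun M => {a, a + 1} ⊆ M) = {{a, a + 1}} := by
      ext M
      rw [Finset.mem_filter, Finset.mem_singleton]
      constructor
      · rintro ⟨hM, haM⟩
        exact (Finset.eq_of_subset_of_card_le haM ((card_le_two_of_mem_biUnion_powerset_polygon hM).trans
          (card_polygon_edge (by omega) a).ge)).symm
      · rintro rfl
        exact ⟨hG, subset_rfl⟩
    rw [hset, Finset.sum_singleton, card_polygon_edge (by omega) a, even_two.neg_one_pow]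

/-- Dehn–Sommerville for the `n`-gon via the tree's Theorem 5.4.2: `h_i = h_{2−i}` (here
`(1, n−2, 1)` is visibly palindromic). [cite: BrunsHerzog1998, Thm. 5.4.2] -/
theorem coeff_hPolynomial_polygon_symm (hn : 3 ≤ n) {i : ℕ} (hi : i ≤ 2) :
    (∑ G ∈ ((univ : Finset (Fin n)).image (fun a : Fin n => ({a, a + 1} : Finset (Fin n)))).biUnion
        Finset.powerset, (Polynomial.X : Polynomial ℤ) ^ G.card * (1 - Polynomial.X) ^ (2 - G.card)).coeff i =
      (∑ G ∈ ((univ : Finset (Fin n)).image (fun a : Fin n => ({a, a + 1} : Finset (Fin n)))).biUnion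
        Finset.powerset, (Polynomial.X : Polynomial ℤ) ^ G.card * (1 - Polynomial.X) ^ (2 - G.card)).coeff
          (2 - i) :=
  coeff_hPolynomial_symm _ (fun _ hF _ hGF => mem_biUnion_powerset_of_subset hGF hF)
    (fun _ hG => card_le_two_of_mem_biUnion_powerset_polygon hG) (euler_polygon hn) hi

/-! ### § 4 `Δ(n,2)` is the `n`-gon: Gale's evenness condition for `2`-sets -/

/-- **An edge `{a, a+1}` satisfies Gale's evenness condition**: between two non-vertices `i < j`
there are either both of `a, a+1` or none (and the closing edge `{n−1, 0}` has no vertex strictly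
between two others). [cite: BrunsHerzog1998, Thm. 5.2.11 (proof, `j = d − 1`)] -/
theorem gale_polygon_edge (a : Fin n) :
    ∀ i ∉ ({a, a + 1} : Finset (Fin n)), ∀ j ∉ ({a, a + 1} : Finset (Fin n)), i < j →
      Even ((({a, a + 1} : Finset (Fin n)).filter (fun k => i < k ∧ k < j)).card) := by
  obtain ⟨m, rfl⟩ := Nat.exists_eq_succ_of_ne_zero (NeZero.ne n)
  intro i hi j hj hij
  simp only [Finset.mem_insert, Finset.mem_singleton, not_or] at hi hj
  have hval := Fin.val_add_one a
  rw [Finset.filter_insert, Finset.filter_singleton]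
  by_cases ha : a = Fin.last m
  · -- the closing edge `{last, 0}`
    rw [if_pos ha] at hval
    have h1 : ¬ (i < a ∧ a < j) := fun h => by
      have := h.2
      rw [ha] at this
      exact (Fin.le_last j).not_gt this
    have h2 : ¬ (i < a + 1 ∧ a + 1 < j) := fun h => by
      have := h.1
      rw [Fin.lt_def, hval] at this
      exact Nat.not_lt_zero _ this
    rw [if_neg h1, if_neg h2]
    exact ⟨0, rfl⟩
  · rw [if_neg ha] at hval
    have hiff : (i < a ∧ a < j) ↔ (i < a + 1 ∧ a + 1 < j) := by
      simp only [Fin.lt_def, hval]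
      constructor
      · rintro ⟨h1, h2⟩
        refine ⟨by omega, lt_of_le_of_ne (by omega) fun h => hj.2 (Fin.ext (by rw [hval]; omega))⟩
      · rintro ⟨h1, h2⟩
        refine ⟨lt_of_le_of_ne (by omega) fun h => hi.1 (Fin.ext h), by omega⟩
    by_cases h : i < a ∧ a < j
    · rw [if_pos h, if_pos (hiff.mp h), Finset.card_insert_of_notMem (by
        rw [Finset.mem_singleton]; exact (add_one_ne_self (by
          have := a.isLt; have := (Fin.last m).isLt
          rcases Nat.lt_or_ge m 1 with hm | hm
          · exfalso; apply ha; ext; simp [Fin.val_last]; omega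
          · omega) a).symm), Finset.card_singleton]
      exact ⟨1, rfl⟩
    · rw [if_neg h, if_neg (fun h' => h (hiff.mpr h'))]
      exact ⟨0, rfl⟩

/-- **Theorem 5.2.11 for `d = 2`: a `2`-subset of `Fin n` (`n ≥ 3`) satisfies Gale's evenness
condition iff it is an edge `{a, a+1}` of the `n`-gon.** [cite: BrunsHerzog1998, Thm. 5.2.11] -/
theorem gale_two_iff (hn : 3 ≤ n) (F : Finset (Fin n)) :
    (F.card = 2 ∧ ∀ i ∉ F, ∀ j ∉ F, i < j → Even ((F.filter (fun k => i < k ∧ k < j)).card)) ↔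
      ∃ a : Fin n, F = {a, a + 1} := by
  constructor
  · rintro ⟨hF2, hgale⟩
    obtain ⟨x, y, hxy, rfl⟩ := Finset.card_eq_two.mp hF2
    -- order the two vertices
    wlog hlt : x < y generalizing x y
    · have h := this y x hxy.symm (by rwa [Finset.pair_comm]) (by rwa [Finset.pair_comm])
        (lt_of_le_of_ne (not_lt.mp hlt) hxy.symm)
      rwa [Finset.pair_comm] at h
    obtain ⟨m, rfl⟩ := Nat.exists_eq_succ_of_ne_zero (NeZero.ne n)
    have hval := Fin.val_add_one x
    have hxlast : x ≠ Fin.last m := fun h => by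
      rw [h] at hlt
      exact (Fin.le_last y).not_gt hlt
    rw [if_neg hxlast] at hval
    by_cases hy : y = x + 1
    · exact ⟨x, by rw [hy]⟩
    by_cases hx0 : (x : ℕ) = 0 ∧ y = Fin.last m
    · -- the closing edge: `F = {0, last} = {last, last + 1}`
      refine ⟨Fin.last m, ?_⟩
      have h0 : x = Fin.last m + 1 := by
        ext
        rw [Fin.val_add_one, if_pos rfl]
        exact hx0.1
      rw [hx0.2, h0, Finset.pair_comm]
    · exfalso
      have hx1y : ((x : ℕ) + 1) < (y : ℕ) := by
        have h1 : (x : ℕ) < y := hlt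
        rcases Nat.lt_or_ge ((x : ℕ) + 1) y with h | h
        · exact h
        · exfalso
          apply hy
          ext
          rw [hval]
          omega
      have hx1 : x + 1 ∉ ({x, y} : Finset (Fin (m + 1))) := by
        simp only [Finset.mem_insert, Finset.mem_singleton, not_or]
        refine ⟨fun h => ?_, fun h => hy h.symm⟩
        have := congrArg Fin.val h
        rw [hval] at this
        omega
      rw [not_and_or] at hx0
      rcases hx0 with hx0 | hylast
      · -- `0 < x`: between `0` and `x + 1` lies exactly `x`
        have h0 : (0 : Fin (m + 1)) ∉ ({x, y} : Finset (Fin (m + 1))) := by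
          simp only [Finset.mem_insert, Finset.mem_singleton, not_or]
          refine ⟨fun h => hx0 ?_, fun h => ?_⟩
          · rw [← h]; rfl
          · have := congrArg Fin.val h
            simp at this
            omega
        have hodd := hgale 0 h0 (x + 1) hx1 (by rw [Fin.lt_def, hval]; exact Nat.zero_lt_succ _)
        have hpx : (0 : Fin (m + 1)) < x ∧ x < x + 1 :=
          ⟨by rw [Fin.lt_def]; exact Nat.pos_of_ne_zero hx0, by rw [Fin.lt_def, hval]; omega⟩
        have hpy : ¬ ((0 : Fin (m + 1)) < y ∧ y < x + 1) := by
          rintro ⟨-, h⟩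
          rw [Fin.lt_def, hval] at h
          omega
        rw [Finset.filter_insert, Finset.filter_singleton, if_pos hpx, if_neg hpy,
          Finset.insert_empty, Finset.card_singleton] at hodd
        exact Nat.not_even_one hodd
      · -- `y < last`: between `x + 1` and `last` lies exactly `y`
        have hlast : Fin.last m ∉ ({x, y} : Finset (Fin (m + 1))) := by
          simp only [Finset.mem_insert, Finset.mem_singleton, not_or]
          exact ⟨fun h => hxlast h.symm, fun h => hylast h.symm⟩
        have hylt : (y : ℕ) < m := lt_of_le_of_ne (Nat.lt_succ_iff.mp y.isLt)
          fun h => hylast (Fin.ext (by rw [h, Fin.val_last]))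
        have hodd := hgale (x + 1) hx1 (Fin.last m) hlast (by rw [Fin.lt_def, hval, Fin.val_last]; omega)
        have hpx : ¬ (x + 1 < x ∧ x < Fin.last m) := by
          rintro ⟨h, -⟩
          rw [Fin.lt_def, hval] at h
          omega
        have hpy : x + 1 < y ∧ y < Fin.last m := by
          rw [Fin.lt_def, Fin.lt_def, hval, Fin.val_last]
          exact ⟨hx1y, hylt⟩
        rw [Finset.filter_insert, Finset.filter_singleton, if_neg hpx, if_pos hpy,
          Finset.card_singleton] at hodd
        exact Nat.not_even_one hodd
  · rintro ⟨a, rfl⟩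
    exact ⟨card_polygon_edge (by omega) a, gale_polygon_edge a⟩

/-- **`Δ(n,2)` is the `n`-gon**: the Gale facet family of `CyclicPolytopeGaleComplex` with `d = 2` is
the family of edges `{a, a+1}`, `a ∈ Fin n` (`n ≥ 3`). [cite: BrunsHerzog1998, Thm. 5.2.11 and
Cor. 5.2.12] [cite: Stanley1996, Problems on Simplicial Complexes, Problem 6] -/
theorem galeFacets_two_eq_polygon (hn : 3 ≤ n) :
    (univ : Finset (Finset (Fin n))).filter (fun F => F.card = 2 ∧
        ∀ i ∉ F, ∀ j ∉ F, i < j → Even ((F.filter (fun k => i < k ∧ k < j)).card)) =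
      (univ : Finset (Fin n)).image (fun a : Fin n => ({a, a + 1} : Finset (Fin n))) := by
  ext F
  rw [Finset.mem_filter, Finset.mem_image, gale_two_iff hn]
  simp only [Finset.mem_univ, true_and]
  exact ⟨fun ⟨a, h⟩ => ⟨a, h.symm⟩, fun ⟨a, h⟩ => ⟨a, h.symm⟩⟩

/-- **`h_1(k[Δ(n,2)]) = n − 2`** for the Gale complex with `d = 2`, completing Problem 6 for `d = 2`:
`h(Δ(n,2)) = (1, n − 2, 1)` (`n ≥ 3`, `k` infinite; `h_0 = 1` and `h_1 = n − 2 = binom(n−2+1−1, 1)`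
are McMullen's (a), and `h_2 = h_0` is Dehn–Sommerville). [cite: Stanley1996, Problems on Simplicial
Complexes, Problem 6] [cite: BrunsHerzog1998, §5.2 p. 227 (a), (c)] -/
theorem coeff_one_sub_X_pow_mul_hilbertSeries_galeFacets_two {k : Type u} [Field k] [Infinite k]
    (hn : 3 ≤ n) :
    (PowerSeries.coeff 1 ((1 - PowerSeries.X : ℤ⟦X⟧) ^ 2 * PowerSeries.mk (fun e =>
        ((finrank k (MvPolynomial.homogeneousSubmodule (Fin n) k e) -
          finrank k (idealDegree (projVanishingIdeal
            {p : Fin n → k | ∃ F ∈ (univ : Finset (Finset (Fin n))).filter (fun F => F.card = 2 ∧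
              ∀ i ∉ F, ∀ j ∉ F, i < j → Even ((F.filter (fun k => i < k ∧ k < j)).card)),
                ∀ v ∉ F, p v = 0}) e) : ℕ) : ℤ))) = (n : ℤ) - 2) ∧
    (PowerSeries.coeff 2 ((1 - PowerSeries.X : ℤ⟦X⟧) ^ 2 * PowerSeries.mk (fun e =>
        ((finrank k (MvPolynomial.homogeneousSubmodule (Fin n) k e) -
          finrank k (idealDegree (projVanishingIdeal
            {p : Fin n → k | ∃ F ∈ (univ : Finset (Finset (Fin n))).filter (fun F => F.card = 2 ∧
              ∀ i ∉ F, ∀ j ∉ F, i < j → Even ((F.filter (fun k => i < k ∧ k < j)).card)),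
                ∀ v ∉ F, p v = 0}) e) : ℕ) : ℤ))) = 1) := by
  rw [galeFacets_two_eq_polygon hn]
  exact ⟨(coeff_one_sub_X_pow_mul_hilbertSeries_polygon hn).2.1,
    (coeff_one_sub_X_pow_mul_hilbertSeries_polygon hn).2.2⟩

end Literature.AlgebraicGeometry.ProjectiveSpace
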